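import Summits.ValiantsHypothesis.ValiantsHypothesis.Theorems.DepthWindowJumpFactors
import Summits.ValiantsHypothesis.ValiantsHypothesis.Theorems.DepthWindowHomBlocks
import Literature.Computability.AlgebraicComplexity.CircuitGateSemantics
import HarnessLib

/-!
# Route `DepthWindow`, g8 — the jump factors as circuit operands

Operand side of the leaf algebra of piece (iv) of the `(2,3)` SLIVER LEMMA (lens-4 NODE-v8 §11):
given operands `cmp l ε` (into a gate list with values `V` and depth list `D`) computing the weight
components `[U_l]_ε` for `l < t`, `ε ≤ d`, the factors `jumpFactor` / `idFactor` / `finFactor` of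
`Theorems/DepthWindowJumpFactors.lean` are the values of explicit OPERANDS `jumpFactorOp` /
`idFactorOp` / `finFactorOp` (a component operand or a constant `0`/`1`), which reference below
whatever the `cmp` reference below and have depth at most that of the `cmp`.  These are the `leaf` /
`extra` tables fed to `exists_append_sumProdSumProdMul`.  Pure bookkeeping; nothing here bears on
`VP ≠ VNP`.

[cite: LimayeSrinivasanTavenas2025, Lemma 11] [cite: Burgisser2000, Def. 2.1]
-/

set_option linter.dupNamespace false

namespace Summit.ValiantsHypothesis.ValiantsHypothesis.Theorems.DepthWindow

open Finset MvPolynomial Literature.Computability.AlgebraicComplexity ArithCircuit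

variable {k : Type*} [CommRing k] {τ : Type*}

/-- Operand for jump factor `l` of the transition `x → y` (cf. `jumpFactor`). -/
def jumpFactorOp (d t : ℕ) (cmp : ℕ → ℕ → Operand k τ) (x y : Fin (d + 1) × Fin (t + 1))
    (l : Fin (t + 1)) : Operand k τ :=
  if (l : ℕ) = t then (if (x.2 : ℕ) < y.2 ∧ (x.1 : ℕ) < y.1 then Operand.const 1 else Operand.const 0)
  else if (x.2 : ℕ) ≤ l ∧ (l : ℕ) + 1 < y.2 then cmp l 0
  else if (l : ℕ) + 1 = y.2 then cmp l ((y.1 : ℕ) - x.1)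
  else Operand.const 1

/-- Operand for identity factor `l` (cf. `idFactor`). -/
def idFactorOp (d t : ℕ) (x y : Fin (d + 1) × Fin (t + 1)) (l : Fin (t + 1)) : Operand k τ :=
  if (l : ℕ) = t then (if x = y then Operand.const 1 else Operand.const 0) else Operand.const 1

/-- Operand for terminal factor `l` (cf. `finFactor`). -/
def finFactorOp (d t e : ℕ) (cmp : ℕ → ℕ → Operand k τ) (y : Fin (d + 1) × Fin (t + 1))
    (l : Fin (t + 1)) : Operand k τ :=
  if (l : ℕ) = t then (if (y.1 : ℕ) = e then Operand.const 1 else Operand.const 0)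
  else if (y.2 : ℕ) ≤ l then cmp l 0 else Operand.const 1

section Semantics

variable (w : τ → ℕ) (d t : ℕ) (U : ℕ → MvPolynomial τ k) (cmp : ℕ → ℕ → Operand k τ)
  (V : List (MvPolynomial τ k)) (D : List ℕ) (n D₀ : ℕ)

/-- Value of the jump factor operand. -/
theorem eval_jumpFactorOp
    (hev : ∀ l ε, l < t → ε ≤ d → (cmp l ε).eval V = weightedHomogeneousComponent w ε (U l))
    (x y : Fin (d + 1) × Fin (t + 1)) (l : Fin (t + 1)) :
    (jumpFactorOp d t cmp x y l).eval V = jumpFactor w d t U x y l := by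
  unfold jumpFactorOp jumpFactor
  have hy1 := y.1.isLt
  have hy2 := y.2.isLt
  by_cases h0 : (l : ℕ) = t
  · simp only [if_pos h0]
    by_cases hv : (x.2 : ℕ) < y.2 ∧ (x.1 : ℕ) < y.1
    · simp only [if_pos hv, Operand.eval, C_1]
    · simp only [if_neg hv, Operand.eval, C_0]
  · simp only [if_neg h0]
    have hl : (l : ℕ) < t := by have := l.isLt; omega
    by_cases h1 : (x.2 : ℕ) ≤ l ∧ (l : ℕ) + 1 < y.2
    · simp only [if_pos h1]; exact hev l 0 hl (Nat.zero_le d)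
    · simp only [if_neg h1]
      by_cases h2 : (l : ℕ) + 1 = y.2
      · simp only [if_pos h2]; exact hev l _ hl (by omega)
      · simp only [if_neg h2, Operand.eval, C_1]

/-- Value of the identity factor operand. -/
theorem eval_idFactorOp (x y : Fin (d + 1) × Fin (t + 1)) (l : Fin (t + 1)) :
    (idFactorOp d t x y l : Operand k τ).eval V = idFactor d t x y l := by
  unfold idFactorOp idFactor
  by_cases h0 : (l : ℕ) = t
  · simp only [if_pos h0]
    by_cases hxy : x = y
    · simp only [if_pos hxy, Operand.eval, C_1]
    · simp only [if_neg hxy, Operand.eval, C_0]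
  · simp only [if_neg h0, Operand.eval, C_1]

/-- Value of the terminal factor operand. -/
theorem eval_finFactorOp (e : ℕ)
    (hev : ∀ l ε, l < t → ε ≤ d → (cmp l ε).eval V = weightedHomogeneousComponent w ε (U l))
    (y : Fin (d + 1) × Fin (t + 1)) (l : Fin (t + 1)) :
    (finFactorOp d t e cmp y l).eval V = finFactor w d t e U y l := by
  unfold finFactorOp finFactor
  by_cases h0 : (l : ℕ) = t
  · simp only [if_pos h0]
    by_cases hy : (y.1 : ℕ) = e
    · simp only [if_pos hy, Operand.eval, C_1]
    · simp only [if_neg hy, Operand.eval, C_0]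
  · simp only [if_neg h0]
    have hl : (l : ℕ) < t := by have := l.isLt; omega
    by_cases h1 : (y.2 : ℕ) ≤ l
    · simp only [if_pos h1]; exact hev l 0 hl (Nat.zero_le d)
    · simp only [if_neg h1, Operand.eval, C_1]

/-- References of the jump factor operand. -/
theorem jumpFactorOp_refsBelow (hrefs : ∀ l ε, l < t → ε ≤ d → (cmp l ε).RefsBelow n)
    (x y : Fin (d + 1) × Fin (t + 1)) (l : Fin (t + 1)) :
    (jumpFactorOp d t cmp x y l).RefsBelow n := by
  unfold jumpFactorOp
  have hy1 := y.1.isLt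
  by_cases h0 : (l : ℕ) = t
  · simp only [if_pos h0]
    by_cases hv : (x.2 : ℕ) < y.2 ∧ (x.1 : ℕ) < y.1
    · simp only [if_pos hv]; trivial
    · simp only [if_neg hv]; trivial
  · simp only [if_neg h0]
    have hl : (l : ℕ) < t := by have := l.isLt; omega
    by_cases h1 : (x.2 : ℕ) ≤ l ∧ (l : ℕ) + 1 < y.2
    · simp only [if_pos h1]; exact hrefs l 0 hl (Nat.zero_le d)
    · simp only [if_neg h1]
      by_cases h2 : (l : ℕ) + 1 = y.2
      · simp only [if_pos h2]; exact hrefs l _ hl (by omega)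
      · simp only [if_neg h2]; trivial

/-- Depth of the jump factor operand. -/
theorem jumpFactorOp_depthIn
    (hdp : ∀ l ε, l < t → ε ≤ d → (cmp l ε).depthIn D ≤ D₀)
    (x y : Fin (d + 1) × Fin (t + 1)) (l : Fin (t + 1)) :
    (jumpFactorOp d t cmp x y l).depthIn D ≤ D₀ := by
  unfold jumpFactorOp
  have hy1 := y.1.isLt
  by_cases h0 : (l : ℕ) = t
  · simp only [if_pos h0]
    by_cases hv : (x.2 : ℕ) < y.2 ∧ (x.1 : ℕ) < y.1
    · simp only [if_pos hv]; exact Nat.zero_le _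
    · simp only [if_neg hv]; exact Nat.zero_le _
  · simp only [if_neg h0]
    have hl : (l : ℕ) < t := by have := l.isLt; omega
    by_cases h1 : (x.2 : ℕ) ≤ l ∧ (l : ℕ) + 1 < y.2
    · simp only [if_pos h1]; exact hdp l 0 hl (Nat.zero_le d)
    · simp only [if_neg h1]
      by_cases h2 : (l : ℕ) + 1 = y.2
      · simp only [if_pos h2]; exact hdp l _ hl (by omega)
      · simp only [if_neg h2]; exact Nat.zero_le _

/-- References of the identity factor operand. -/
theorem idFactorOp_refsBelow (x y : Fin (d + 1) × Fin (t + 1)) (l : Fin (t + 1)) :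
    (idFactorOp d t x y l : Operand k τ).RefsBelow n := by
  unfold idFactorOp
  by_cases h0 : (l : ℕ) = t
  · simp only [if_pos h0]
    by_cases hxy : x = y
    · simp only [if_pos hxy]; trivial
    · simp only [if_neg hxy]; trivial
  · simp only [if_neg h0]; trivial

/-- Depth of the identity factor operand. -/
theorem idFactorOp_depthIn (x y : Fin (d + 1) × Fin (t + 1)) (l : Fin (t + 1)) :
    (idFactorOp d t x y l : Operand k τ).depthIn D = 0 := by
  unfold idFactorOp
  by_cases h0 : (l : ℕ) = t
  · simp only [if_pos h0]
    by_cases hxy : x = y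
    · simp only [if_pos hxy]; rfl
    · simp only [if_neg hxy]; rfl
  · simp only [if_neg h0]; rfl

/-- References of the terminal factor operand. -/
theorem finFactorOp_refsBelow (e : ℕ)
    (hrefs : ∀ l ε, l < t → ε ≤ d → (cmp l ε).RefsBelow n)
    (y : Fin (d + 1) × Fin (t + 1)) (l : Fin (t + 1)) :
    (finFactorOp d t e cmp y l).RefsBelow n := by
  unfold finFactorOp
  by_cases h0 : (l : ℕ) = t
  · simp only [if_pos h0]
    by_cases hy : (y.1 : ℕ) = e
    · simp only [if_pos hy]; trivial
    · simp only [if_neg hy]; trivial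
  · simp only [if_neg h0]
    have hl : (l : ℕ) < t := by have := l.isLt; omega
    by_cases h1 : (y.2 : ℕ) ≤ l
    · simp only [if_pos h1]; exact hrefs l 0 hl (Nat.zero_le d)
    · simp only [if_neg h1]; trivial

/-- Depth of the terminal factor operand. -/
theorem finFactorOp_depthIn (e : ℕ)
    (hdp : ∀ l ε, l < t → ε ≤ d → (cmp l ε).depthIn D ≤ D₀)
    (y : Fin (d + 1) × Fin (t + 1)) (l : Fin (t + 1)) :
    (finFactorOp d t e cmp y l).depthIn D ≤ D₀ := by
  unfold finFactorOp
  by_cases h0 : (l : ℕ) = t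
  · simp only [if_pos h0]
    by_cases hy : (y.1 : ℕ) = e
    · simp only [if_pos hy]; exact Nat.zero_le _
    · simp only [if_neg hy]; exact Nat.zero_le _
  · simp only [if_neg h0]
    have hl : (l : ℕ) < t := by have := l.isLt; omega
    by_cases h1 : (y.2 : ℕ) ≤ l
    · simp only [if_pos h1]; exact hdp l 0 hl (Nat.zero_le d)
    · simp only [if_neg h1]; exact Nat.zero_le _

end Semantics

end Summit.ValiantsHypothesis.ValiantsHypothesis.Theorems.DepthWindow
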